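import Summits.Ventures.LatticeQCDFlow.Scoring.KernelTransitionOperator

/-!
HONEST FRAMING: exact (Metropolis-corrected) sampling algorithms for lattice gauge theory; figures
of merit are autocorrelation/cost numbers at stated couplings and volumes; no continuum-physics
claim.

# LevelAutocorrelationFloor — AN OBSERVABLE THAT ONE STEP OF A STATIONARY MARKOV CHAIN MOVES BY AT MOST `ℓ`, AND
# MOVES AT ALL WITH STATIONARY PROBABILITY `ā`, HAS LAG-ONE AUTOCOVARIANCE `≥ Var − ℓ²ā/2`; THE LEVEL OF ANY
# NEAREST-NEIGHBOUR LADDER SAMPLER WITH `K + 1` EQUALLY VISITED LEVELS HAS `ρ_level(1) ≥ 1 − 6ā/(K(K+2))`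
# (lean-2 GEN-13, ours)

Venture-side (OURS).  Cell `lqcd-flow` (pub-lqcd), unit `pub-lqcd-lean-2-g13`, 2026-08-23.  GEN-11/12 bounded the
ACCEPTANCE of every coupling-transfer protocol (replica-exchange swap, simulated-tempering level move, flow /
independence proposal, boundary-condition tempering) and the number of ladder rungs it needs, leaving
"round-trip / autocorrelation times of tempering processes" NOT CLAIMED.  This file is the kernel-level tool for
that: a ONE-STEP MOVEMENT BOUND on the stationary lag-one autocovariance of an observable under an ARBITRARY
Markov kernel with an invariant probability law (Mathlib's `ProbabilityTheory.Kernel`, `Kernel.Invariant`; the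
cell's transition operator `Scoring.kop` and stationary second moment `Scoring.autocov` of
`Scoring/KernelTransitionOperator.lean`).  The companion `Scaling/SimulatedTemperingDiffusive.lean` docks it to
simulated tempering in the coupling with exact weights and to the Wilson measure of every compact gauge group.

## What is proved

* §1 (general measurable `E`, Markov kernel `κ`, invariant probability `π`, bounded measurable `f`, `|f| ≤ B`):
  `integral_sq_sub_eq` — `∫ (f y − f x)² κ(x,dy) = (κf²)(x) − 2f(x)(κf)(x) + f(x)²`; **`dirichlet_identity`** —
  `∫∫ (f y − f x)² κ(x,dy) π(dx) = 2·(∫ f² dπ − autocov κ π f 1)` (invariance: `∫ κf² dπ = ∫ f² dπ`);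
  `integral_sq_sub_le_of_moves` — if `|f y − f x| ≤ ℓ` for `κ(x,·)`-a.e. `y` then
  `∫ (f y − f x)² κ(x,dy) ≤ ℓ²·κ(x, {f ≠ f x})`; **`sq_integral_sub_autocov_le`** — THE MOVEMENT BOUND: if moreover
  `κ(x, {f ≠ f(x)}) ≤ r(x)` for a measurable `0 ≤ r ≤ R`, then
  `∫ f² dπ − autocov κ π f 1 ≤ (ℓ²/2)·∫ r dπ`, i.e. `Cov_π(f(X₀), f(X₁)) ≥ Var_π(f) − ℓ²ā/2` with `ā = ∫ r dπ`
  any bound on the stationary probability that `f` moves (`variance_sub_lagOneCov_le`).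
* §2 (a LEVEL `lev : E → ℕ`, measurable, that the kernel moves by at most one step: `|lev y − lev x| ≤ 1`
  for `κ(x,·)`-a.e. `y` — simulated / parallel tempering, expanded ensembles, any ladder method with
  nearest-neighbour index moves, WHATEVER the within-level dynamics): `level_sq_integral_sub_autocov_le`
  (`ℓ = 1`); for EQUALLY VISITED levels `0, …, K` (`π{lev = k} = 1/(K+1)` — exact free-energy weights):
  `integral_comp_level_eq`, `level_mean_eq` (`= K/2`), `level_sq_mean_eq` (`= K(2K+1)/6`), `level_variance_eq`
  (`= K(K+2)/12`), and **`level_lagOneCov_ge`** / **`level_lagOneAutocorr_ge`** (`K ≥ 1`):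
  `Cov_π(lev(X₀), lev(X₁)) ≥ K(K+2)/12 − ā/2`, `ρ_lev(1) ≥ 1 − 6ā/(K(K+2))`.
* §3 **`ladder_rate_kfree`**: for `A > 0` and every real `K ≥ 1`, `12·exp(−A/K²)/((K+1)(K+2)) ≤ 12/(e·A)`
  (`x·e^{−Ax} ≤ 1/(e·A)` at `x = 1/K²`) — the ladder-size-free form used by the companion file
  (there `ā ≤ 2e^{−A/K²}`, `A = m(b−a)²/8`).

Reading (no numerics implied): refining a ladder (`K` large) makes each level move likely but the level must
diffuse over `K` rungs (`1 − ρ ≤ 6/K²`-type); coarsening it makes level moves rare (`ā` small); the product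
bound is ladder-size-free once `ā` is controlled by the overlap of adjacent rungs.  NOT CLAIMED: spectral gaps /
relaxation times (for a reversible kernel `1 − ρ_f(1) ≥ gap` for every `f`, so these floors are relaxation-time
floors — not typed here), higher lags, round-trip times as stopping times, anything about a specific sampler.
Literature grade (cell rule): KNOWN MECHANISM (Dirichlet-form / conductance bounds; diffusive ladder motion of
tempering — Katzgraber–Trebst–Huse–Troyer 2006; torpid-mixing bounds for simulated and parallel tempering via the
overlap of adjacent levels — Woodard–Schmidler–Huber, Electron. J. Probab. 14 (2009) 780), NEW TYPING (kernel
level, every within-level dynamics, explicit constants); nothing cited as a fact.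
-/

noncomputable section

open MeasureTheory ProbabilityTheory Set Filter Finset
open Summit.Ventures.LatticeQCDFlow.Scoring

namespace Summit.Ventures.LatticeQCDFlow.Scaling

/-! ## §1 The one-step movement bound for an arbitrary stationary Markov kernel -/

section General

variable {E : Type*} [MeasurableSpace E] {κ : Kernel E E} [IsMarkovKernel κ] {π : Measure E}
  [IsProbabilityMeasure π] {f : E → ℝ} {B : ℝ}

/-- `∫ (f y − f x)² κ(x,dy) = (κf²)(x) − 2·f(x)·(κf)(x) + f(x)²` for bounded measurable `f`. [folklore] -/
theorem integral_sq_sub_eq (hfm : Measurable f) (hfb : ∀ x, |f x| ≤ B) (x : E) :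
    ∫ y, (f y - f x) ^ 2 ∂(κ x) =
      kop κ (fun y => f y ^ 2) x - 2 * f x * kop κ f x + f x ^ 2 := by
  have hB2 : ∀ y, |f y ^ 2| ≤ B ^ 2 := fun y => by
    rw [abs_pow]; exact pow_le_pow_left₀ (abs_nonneg _) (hfb y) 2
  have h1 : Integrable (fun y => f y ^ 2) (κ x) := integrable_of_bounded (κ x) (hfm.pow_const 2) hB2
  have h2 : Integrable (fun y => 2 * f x * f y) (κ x) := (integrable_of_bounded (κ x) hfm hfb).const_mul _
  have h12 : Integrable (fun y => f y ^ 2 - 2 * f x * f y) (κ x) := h1.sub h2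
  have e : ∫ y, (f y - f x) ^ 2 ∂(κ x) = ∫ y, (f y ^ 2 - 2 * f x * f y) + f x ^ 2 ∂(κ x) :=
    integral_congr_ae (ae_of_all _ fun y => by ring)
  rw [e, integral_add h12 (integrable_const _), integral_sub h1 h2, integral_const_mul, integral_const,
    probReal_univ, one_smul]
  rfl

/-- **THE DIRICHLET IDENTITY**: for `π` invariant under the Markov kernel `κ` and bounded measurable `f`,
`∫∫ (f y − f x)² κ(x,dy) π(dx) = 2·(∫ f² dπ − autocov κ π f 1)` — twice the gap between the stationary
variance-type second moment and the lag-one second moment `E_π[f(X₀)f(X₁)]`. [folklore] -/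
theorem dirichlet_identity (hπ : Kernel.Invariant κ π) (hfm : Measurable f) (hfb : ∀ x, |f x| ≤ B) :
    ∫ x, ∫ y, (f y - f x) ^ 2 ∂(κ x) ∂π = 2 * (∫ x, f x ^ 2 ∂π - autocov κ π f 1) := by
  have hB2 : ∀ y, |f y ^ 2| ≤ B ^ 2 := fun y => by
    rw [abs_pow]; exact pow_le_pow_left₀ (abs_nonneg _) (hfb y) 2
  have hkf2m : Measurable (kop κ fun y => f y ^ 2) := measurable_kop κ (hfm.pow_const 2)
  have hkf2b : ∀ x, |kop κ (fun y => f y ^ 2) x| ≤ B ^ 2 := abs_kop_le κ hB2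
  have hkfm : Measurable (kop κ f) := measurable_kop κ hfm
  have hkfb : ∀ x, |kop κ f x| ≤ B := abs_kop_le κ hfb
  have i1 : Integrable (kop κ fun y => f y ^ 2) π := integrable_of_bounded π hkf2m hkf2b
  have i2 : Integrable (fun x => 2 * f x * kop κ f x) π := by
    refine integrable_of_bounded π ((hfm.const_mul 2).mul hkfm) (C := 2 * B * B) fun x => ?_
    rw [abs_mul, abs_mul, abs_two]
    exact mul_le_mul (mul_le_mul_of_nonneg_left (hfb x) zero_le_two) (hkfb x) (abs_nonneg _)
      (mul_nonneg zero_le_two ((abs_nonneg _).trans (hfb x)))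
  have i3 : Integrable (fun x => f x ^ 2) π := integrable_of_bounded π (hfm.pow_const 2) hB2
  have i12 : Integrable (fun x => kop κ (fun y => f y ^ 2) x - 2 * f x * kop κ f x) π := i1.sub i2
  have e : ∫ x, ∫ y, (f y - f x) ^ 2 ∂(κ x) ∂π =
      ∫ x, (kop κ (fun y => f y ^ 2) x - 2 * f x * kop κ f x) + f x ^ 2 ∂π :=
    integral_congr_ae (ae_of_all _ fun x => integral_sq_sub_eq hfm hfb x)
  rw [e, integral_add i12 i3, integral_sub i1 i2, integral_kop κ hπ (hfm.pow_const 2) hB2]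
  have ea : autocov κ π f 1 = ∫ x, f x * kop κ f x ∂π := by
    simp only [autocov, Function.iterate_one]
  have e2 : ∫ x, 2 * f x * kop κ f x ∂π = 2 * ∫ x, f x * kop κ f x ∂π := by
    rw [← integral_const_mul]
    refine integral_congr_ae (ae_of_all _ fun x => ?_)
    ring
  rw [ea, e2]
  ring

/-- **One step moves `f` by at most `ℓ`** ⇒ `∫ (f y − f x)² κ(x,dy) ≤ ℓ²·κ(x, {y | f y ≠ f x})`. [folklore] -/
theorem integral_sq_sub_le_of_moves (hfm : Measurable f) (hfb : ∀ x, |f x| ≤ B) {ℓ : ℝ}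
    (hmove : ∀ x, ∀ᵐ y ∂(κ x), |f y - f x| ≤ ℓ) (x : E) :
    ∫ y, (f y - f x) ^ 2 ∂(κ x) ≤ ℓ ^ 2 * (κ x).real {y | f y ≠ f x} := by
  have hS : MeasurableSet {y | f y ≠ f x} := (hfm (measurableSet_singleton (f x))).compl
  have hB2 : ∀ y, |f y ^ 2| ≤ B ^ 2 := fun y => by
    rw [abs_pow]; exact pow_le_pow_left₀ (abs_nonneg _) (hfb y) 2
  calc ∫ y, (f y - f x) ^ 2 ∂(κ x)
      ≤ ∫ y, {y | f y ≠ f x}.indicator (fun _ => ℓ ^ 2) y ∂(κ x) := by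
        refine integral_mono_ae ?_ ((integrable_const (ℓ ^ 2)).indicator hS) ?_
        · have e : (fun y => (f y - f x) ^ 2) = fun y => (f y ^ 2 - 2 * f x * f y) + f x ^ 2 := by
            funext y; ring
          rw [e]
          have h12 : Integrable (fun y => f y ^ 2 - 2 * f x * f y) (κ x) :=
            (integrable_of_bounded (κ x) (hfm.pow_const 2) hB2).sub
              ((integrable_of_bounded (κ x) hfm hfb).const_mul _)
          exact h12.add (integrable_const _)
        · filter_upwards [hmove x] with y hy
          by_cases h : f y = f x
          · have : y ∉ {y | f y ≠ f x} := by simpa using h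
            rw [Set.indicator_of_notMem this, h, sub_self]
            simp
          · have : y ∈ {y | f y ≠ f x} := h
            rw [Set.indicator_of_mem this, ← sq_abs]
            exact pow_le_pow_left₀ (abs_nonneg _) hy 2
    _ = ℓ ^ 2 * (κ x).real {y | f y ≠ f x} := by
        rw [integral_indicator_const _ hS, smul_eq_mul, mul_comm]

/-- **THE ONE-STEP MOVEMENT BOUND** (general form).  `κ` Markov with invariant probability `π`; `f` bounded
measurable; one step moves `f` by at most `ℓ` (`|f y − f x| ≤ ℓ` for `κ(x,·)`-a.e. `y`) and moves it at all with
probability `κ(x, {f ≠ f(x)}) ≤ r(x)`, `r` measurable with `0 ≤ r ≤ R`.  Then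
`∫ f² dπ − autocov κ π f 1 ≤ (ℓ²/2)·∫ r dπ`. [ours] -/
theorem sq_integral_sub_autocov_le (hπ : Kernel.Invariant κ π) (hfm : Measurable f) (hfb : ∀ x, |f x| ≤ B)
    {ℓ : ℝ} (hmove : ∀ x, ∀ᵐ y ∂(κ x), |f y - f x| ≤ ℓ) {r : E → ℝ} (hrm : Measurable r) {R : ℝ}
    (hr0 : ∀ x, 0 ≤ r x) (hrR : ∀ x, r x ≤ R) (hrate : ∀ x, (κ x).real {y | f y ≠ f x} ≤ r x) :
    ∫ x, f x ^ 2 ∂π - autocov κ π f 1 ≤ ℓ ^ 2 / 2 * ∫ x, r x ∂π := by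
  have hD := dirichlet_identity hπ hfm hfb
  have hrb : ∀ x, |r x| ≤ R := fun x => by rw [abs_of_nonneg (hr0 x)]; exact hrR x
  have hB2 : ∀ y, |f y ^ 2| ≤ B ^ 2 := fun y => by
    rw [abs_pow]; exact pow_le_pow_left₀ (abs_nonneg _) (hfb y) 2
  -- the Dirichlet integrand, in its measurable expanded form, is dominated by `ℓ²·r`
  have hle : ∫ x, ∫ y, (f y - f x) ^ 2 ∂(κ x) ∂π ≤ ∫ x, ℓ ^ 2 * r x ∂π := by
    have e : ∫ x, ∫ y, (f y - f x) ^ 2 ∂(κ x) ∂π =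
        ∫ x, (kop κ (fun y => f y ^ 2) x - 2 * f x * kop κ f x) + f x ^ 2 ∂π :=
      integral_congr_ae (ae_of_all _ fun x => integral_sq_sub_eq hfm hfb x)
    have hkfm : Measurable (kop κ f) := measurable_kop κ hfm
    have hkfb : ∀ x, |kop κ f x| ≤ B := abs_kop_le κ hfb
    have i1 : Integrable (kop κ fun y => f y ^ 2) π :=
      integrable_of_bounded π (measurable_kop κ (hfm.pow_const 2)) (abs_kop_le κ hB2)
    have i2 : Integrable (fun x => 2 * f x * kop κ f x) π := by
      refine integrable_of_bounded π ((hfm.const_mul 2).mul hkfm) (C := 2 * B * B) fun x => ?_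
      rw [abs_mul, abs_mul, abs_two]
      exact mul_le_mul (mul_le_mul_of_nonneg_left (hfb x) zero_le_two) (hkfb x) (abs_nonneg _)
        (mul_nonneg zero_le_two ((abs_nonneg _).trans (hfb x)))
    have i3 : Integrable (fun x => f x ^ 2) π := integrable_of_bounded π (hfm.pow_const 2) hB2
    have i12 : Integrable (fun x => kop κ (fun y => f y ^ 2) x - 2 * f x * kop κ f x) π := i1.sub i2
    rw [e]
    refine integral_mono (i12.add i3) ((integrable_of_bounded π hrm hrb).const_mul _) fun x => ?_
    have h := integral_sq_sub_le_of_moves hfm hfb hmove x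
    rw [integral_sq_sub_eq hfm hfb x] at h
    exact h.trans (mul_le_mul_of_nonneg_left (hrate x) (sq_nonneg ℓ))
  rw [hD, integral_const_mul] at hle
  linarith

/-- The same bound read as **`Cov_π(f(X₀), f(X₁)) ≥ Var_π(f) − ℓ²ā/2`**: with `m = ∫ f dπ`,
`(∫ f² dπ − m²) − (autocov κ π f 1 − m²) ≤ (ℓ²/2)·∫ r dπ`. [ours] -/
theorem variance_sub_lagOneCov_le (hπ : Kernel.Invariant κ π) (hfm : Measurable f) (hfb : ∀ x, |f x| ≤ B)
    {ℓ : ℝ} (hmove : ∀ x, ∀ᵐ y ∂(κ x), |f y - f x| ≤ ℓ) {r : E → ℝ} (hrm : Measurable r) {R : ℝ}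
    (hr0 : ∀ x, 0 ≤ r x) (hrR : ∀ x, r x ≤ R) (hrate : ∀ x, (κ x).real {y | f y ≠ f x} ≤ r x) :
    (∫ x, f x ^ 2 ∂π - (∫ x, f x ∂π) ^ 2) - (autocov κ π f 1 - (∫ x, f x ∂π) ^ 2) ≤
      ℓ ^ 2 / 2 * ∫ x, r x ∂π := by
  have h := sq_integral_sub_autocov_le hπ hfm hfb hmove hrm hr0 hrR hrate
  linarith

end General

/-! ## §2 Ladder samplers: the level moves by at most one rung per step -/

section Level

variable {E : Type*} [MeasurableSpace E] {κ : Kernel E E} [IsMarkovKernel κ] {π : Measure E}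
  [IsProbabilityMeasure π] {lev : E → ℕ} {K : ℕ}

omit [MeasurableSpace E] in
/-- A level bounded by `K` is a bounded real observable. [folklore] -/
theorem abs_level_le (hK : ∀ x, lev x ≤ K) (x : E) : |((lev x : ℕ) : ℝ)| ≤ K := by
  rw [abs_of_nonneg (Nat.cast_nonneg _)]
  exact_mod_cast hK x

/-- **Nearest-neighbour level moves**: `∫ lev² dπ − autocov κ π lev 1 ≤ ½·∫ r dπ` whenever one step changes the
level by at most one (`|lev y − lev x| ≤ 1` for `κ(x,·)`-a.e. `y`) and changes it at all with probability
`κ(x, {lev ≠ lev x}) ≤ r(x)` (`r` measurable, `0 ≤ r ≤ R`). [ours] -/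
theorem level_sq_integral_sub_autocov_le (hπ : Kernel.Invariant κ π) (hlev : Measurable lev)
    (hK : ∀ x, lev x ≤ K) (hnn : ∀ x, ∀ᵐ y ∂(κ x), |((lev y : ℕ) : ℝ) - lev x| ≤ 1)
    {r : E → ℝ} (hrm : Measurable r) {R : ℝ} (hr0 : ∀ x, 0 ≤ r x) (hrR : ∀ x, r x ≤ R)
    (hrate : ∀ x, (κ x).real {y | lev y ≠ lev x} ≤ r x) :
    ∫ x, ((lev x : ℕ) : ℝ) ^ 2 ∂π - autocov κ π (fun x => ((lev x : ℕ) : ℝ)) 1 ≤ 1 / 2 * ∫ x, r x ∂π := by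
  have hfm : Measurable fun x => ((lev x : ℕ) : ℝ) := measurable_from_nat.comp hlev
  have hrate' : ∀ x, (κ x).real {y | ((lev y : ℕ) : ℝ) ≠ ((lev x : ℕ) : ℝ)} ≤ r x := fun x => by
    have e : {y | ((lev y : ℕ) : ℝ) ≠ ((lev x : ℕ) : ℝ)} = {y | lev y ≠ lev x} := by
      ext y; simp only [Set.mem_setOf_eq, ne_eq, Nat.cast_inj]
    rw [e]; exact hrate x
  have h := sq_integral_sub_autocov_le hπ hfm (abs_level_le hK) hnn hrm hr0 hrR hrate'
  simpa using h

/-- **Equally visited levels**: if `π{lev = k} = 1/(K+1)` for every `k ≤ K` (and `lev ≤ K`), then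
`∫ φ(lev) dπ = (K+1)⁻¹·Σ_{k ≤ K} φ(k)` for every `φ`. [folklore] -/
theorem integral_comp_level_eq (hlev : Measurable lev) (hK : ∀ x, lev x ≤ K)
    (hunif : ∀ k, k ≤ K → π.real {x | lev x = k} = 1 / (K + 1)) (φ : ℕ → ℝ) :
    ∫ x, φ (lev x) ∂π = 1 / (K + 1) * ∑ k ∈ range (K + 1), φ k := by
  have hS : ∀ k, MeasurableSet {x | lev x = k} := fun k => hlev (measurableSet_singleton k)
  have e : (fun x => φ (lev x)) = fun x => ∑ k ∈ range (K + 1), {x | lev x = k}.indicator (fun _ => φ k) x := by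
    funext x
    rw [Finset.sum_eq_single (lev x)]
    · rw [Set.indicator_of_mem (by simp)]
    · intro k _ hk
      exact Set.indicator_of_notMem (by simpa using Ne.symm hk) _
    · intro h
      exact absurd (Finset.mem_range.2 (Nat.lt_succ_of_le (hK x))) h
  rw [e, integral_finsetSum _ fun k _ => (integrable_const (φ k)).indicator (hS k), Finset.mul_sum]
  refine Finset.sum_congr rfl fun k hk => ?_
  rw [integral_indicator_const _ (hS k), hunif k (Nat.le_of_lt_succ (Finset.mem_range.1 hk)), smul_eq_mul]

/-- Mean level `= K/2` under equal visits. [folklore] -/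
theorem level_mean_eq (hlev : Measurable lev) (hK : ∀ x, lev x ≤ K)
    (hunif : ∀ k, k ≤ K → π.real {x | lev x = k} = 1 / (K + 1)) :
    ∫ x, ((lev x : ℕ) : ℝ) ∂π = K / 2 := by
  have hsum : ∑ k ∈ range (K + 1), (k : ℝ) = K * (K + 1) / 2 := by
    clear hK hunif hlev
    induction K with
    | zero => simp
    | succ K ih => rw [Finset.sum_range_succ, ih]; push_cast; ring
  rw [integral_comp_level_eq hlev hK hunif (fun k => (k : ℝ)), hsum]
  have : (K : ℝ) + 1 ≠ 0 := by positivity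
  field_simp

/-- Mean squared level `= K(2K+1)/6` under equal visits. [folklore] -/
theorem level_sq_mean_eq (hlev : Measurable lev) (hK : ∀ x, lev x ≤ K)
    (hunif : ∀ k, k ≤ K → π.real {x | lev x = k} = 1 / (K + 1)) :
    ∫ x, ((lev x : ℕ) : ℝ) ^ 2 ∂π = K * (2 * K + 1) / 6 := by
  have hsum : ∑ k ∈ range (K + 1), (k : ℝ) ^ 2 = K * (K + 1) * (2 * K + 1) / 6 := by
    clear hK hunif hlev
    induction K with
    | zero => simp
    | succ K ih => rw [Finset.sum_range_succ, ih]; push_cast; ring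
  rw [integral_comp_level_eq hlev hK hunif (fun k => (k : ℝ) ^ 2), hsum]
  have : (K : ℝ) + 1 ≠ 0 := by positivity
  field_simp

/-- **Level variance `= K(K+2)/12`** under equal visits. [folklore] -/
theorem level_variance_eq (hlev : Measurable lev) (hK : ∀ x, lev x ≤ K)
    (hunif : ∀ k, k ≤ K → π.real {x | lev x = k} = 1 / (K + 1)) :
    ∫ x, ((lev x : ℕ) : ℝ) ^ 2 ∂π - (∫ x, ((lev x : ℕ) : ℝ) ∂π) ^ 2 = K * (K + 2) / 12 := by
  rw [level_sq_mean_eq hlev hK hunif, level_mean_eq hlev hK hunif]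
  ring

/-- **THE LEVEL LAG-ONE COVARIANCE FLOOR** (equally visited levels `0, …, K`, nearest-neighbour level moves,
ANY within-level dynamics): `Cov_π(lev(X₀), lev(X₁)) = autocov κ π lev 1 − (K/2)² ≥ K(K+2)/12 − ā/2`,
`ā = ∫ r dπ` any measurable bound on the probability that the level moves. [ours] -/
theorem level_lagOneCov_ge (hπ : Kernel.Invariant κ π) (hlev : Measurable lev) (hK : ∀ x, lev x ≤ K)
    (hunif : ∀ k, k ≤ K → π.real {x | lev x = k} = 1 / (K + 1))
    (hnn : ∀ x, ∀ᵐ y ∂(κ x), |((lev y : ℕ) : ℝ) - lev x| ≤ 1)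
    {r : E → ℝ} (hrm : Measurable r) {R : ℝ} (hr0 : ∀ x, 0 ≤ r x) (hrR : ∀ x, r x ≤ R)
    (hrate : ∀ x, (κ x).real {y | lev y ≠ lev x} ≤ r x) :
    K * (K + 2) / 12 - 1 / 2 * ∫ x, r x ∂π ≤ autocov κ π (fun x => ((lev x : ℕ) : ℝ)) 1 - ((K : ℝ) / 2) ^ 2 := by
  have h := level_sq_integral_sub_autocov_le hπ hlev hK hnn hrm hr0 hrR hrate
  have hv := level_variance_eq (π := π) hlev hK hunif
  rw [level_mean_eq hlev hK hunif] at hv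
  linarith

/-- **THE LEVEL AUTOCORRELATION FLOOR**: for `K ≥ 1`,
`ρ_lev(1) := Cov_π(lev(X₀), lev(X₁))/Var_π(lev) ≥ 1 − 6ā/(K(K+2))`. [ours] -/
theorem level_lagOneAutocorr_ge (hπ : Kernel.Invariant κ π) (hlev : Measurable lev) (hK : ∀ x, lev x ≤ K)
    (hK1 : 1 ≤ K) (hunif : ∀ k, k ≤ K → π.real {x | lev x = k} = 1 / (K + 1))
    (hnn : ∀ x, ∀ᵐ y ∂(κ x), |((lev y : ℕ) : ℝ) - lev x| ≤ 1)
    {r : E → ℝ} (hrm : Measurable r) {R : ℝ} (hr0 : ∀ x, 0 ≤ r x) (hrR : ∀ x, r x ≤ R)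
    (hrate : ∀ x, (κ x).real {y | lev y ≠ lev x} ≤ r x) :
    1 - 6 * (∫ x, r x ∂π) / (K * (K + 2)) ≤
      (autocov κ π (fun x => ((lev x : ℕ) : ℝ)) 1 - ((K : ℝ) / 2) ^ 2) / (K * (K + 2) / 12) := by
  have h := level_lagOneCov_ge hπ hlev hK hunif hnn hrm hr0 hrR hrate
  have hKpos : (0 : ℝ) < K * (K + 2) := by
    have : (1 : ℝ) ≤ K := by exact_mod_cast hK1
    positivity
  rw [le_div_iff₀ (by positivity), sub_mul, one_mul, div_mul_eq_mul_div]
  have e : 6 * (∫ x, r x ∂π) * (↑K * (↑K + 2) / 12) / (↑K * (↑K + 2)) = 1 / 2 * ∫ x, r x ∂π := by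
    field_simp
    ring
  rw [e]
  linarith

end Level

/-! ## §3 The ladder-size-free optimisation -/

section KFree

/-- **LADDER-SIZE-FREE FORM**: for `A > 0` and every real `K ≥ 1`,
`12·exp(−A/K²)/((K+1)(K+2)) ≤ 12/(e·A)` (maximise `K⁻²e^{−A/K²}` over `K`). [ours] -/
theorem ladder_rate_kfree {A K : ℝ} (hA : 0 < A) (hK : 1 ≤ K) :
    12 * Real.exp (-(A / K ^ 2)) / ((K + 1) * (K + 2)) ≤ 12 / (Real.exp 1 * A) := by
  have hK2 : 0 < K ^ 2 := by positivity
  -- `x·e^{−Ax} ≤ 1/(eA)` at `x = 1/K²` (from `1 + y ≤ e^y` at `y = Ax − 1`)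
  have h1 : 1 / K ^ 2 * Real.exp (-(A / K ^ 2)) ≤ 1 / (Real.exp 1 * A) := by
    set x : ℝ := 1 / K ^ 2 with hx
    have ex : -(A / K ^ 2) = -(A * x) := by rw [hx]; ring
    rw [ex]
    have key : A * x * Real.exp 1 ≤ Real.exp (A * x) := by
      have h := Real.add_one_le_exp (A * x - 1)
      rw [Real.exp_sub, le_div_iff₀ (Real.exp_pos 1)] at h
      linarith
    rw [le_div_iff₀ (mul_pos (Real.exp_pos 1) hA)]
    have e1 : x * Real.exp (-(A * x)) * (Real.exp 1 * A) = (A * x * Real.exp 1) * Real.exp (-(A * x)) := by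
      ring
    rw [e1]
    calc (A * x * Real.exp 1) * Real.exp (-(A * x))
        ≤ Real.exp (A * x) * Real.exp (-(A * x)) := mul_le_mul_of_nonneg_right key (Real.exp_pos _).le
      _ = 1 := by rw [← Real.exp_add, add_neg_cancel, Real.exp_zero]
  -- `1/((K+1)(K+2)) ≤ 1/K²`
  have h2 : Real.exp (-(A / K ^ 2)) / ((K + 1) * (K + 2)) ≤ 1 / K ^ 2 * Real.exp (-(A / K ^ 2)) := by
    rw [div_le_iff₀ (by positivity), mul_comm (1 / K ^ 2), mul_assoc]
    refine le_mul_of_one_le_right (Real.exp_pos _).le ?_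
    rw [one_div_mul_eq_div, le_div_iff₀ hK2]
    nlinarith
  calc 12 * Real.exp (-(A / K ^ 2)) / ((K + 1) * (K + 2))
        = 12 * (Real.exp (-(A / K ^ 2)) / ((K + 1) * (K + 2))) := by ring
    _ ≤ 12 * (1 / (Real.exp 1 * A)) := mul_le_mul_of_nonneg_left (h2.trans h1) (by norm_num)
    _ = 12 / (Real.exp 1 * A) := by ring

end KFree

end Summit.Ventures.LatticeQCDFlow.Scaling

end
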